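import Literature.NumberTheory.Sieve.GreenTao2008Majorant
import Literature.NumberTheory.Sieve.GreenTao2008Proofs
import Literature.NumberTheory.Sieve.LinearEquationsInPrimesGowersCauchySchwarz
import Literature.Combinatorics.Additive.RelativeSzemeredi
import HarnessLib

/-!
# Green–Tao (2008) Theorem 3.5 via Conlon–Fox–Zhao: the linear forms conditions compared

Trunk T-SIEVE. Green–Tao's relative Szemerédi theorem (Thm. 3.5, the named fact
`Literature.NumberTheory.Sieve.GreenTao2008.RelativeSzemeredi`) is stated for `k`-pseudorandom measures (Def. 3.3: the
`(k 2^{k-1}, 3k-4, k)`-linear forms condition AND the `2^{k-1}`-correlation condition).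
Conlon–Fox–Zhao's relative Szemerédi theorem (`Literature.Combinatorics.Additive.CFZ.RelativeSzemeredi`, EMS Surv. 1 (2014)
Thm. 4.3 = GAFA 25 (2015)) needs only their `k`-linear forms condition
(`Literature.Combinatorics.Additive.CFZ.LinearFormsCondition`, Def. 4.2), which — as remarked in §1 of the exposition
("a weakening of the linear forms condition is sufficient") — is implied by Green–Tao's. This
file proves that implication and deduces Green–Tao's Theorem 3.5 from the Conlon–Fox–Zhao
theorem:

* `cfzLinearFormsCondition_of_gt : 3 ≤ k → GreenTao2008.LinearFormsCondition (k 2^{k-1}) (3k-4) k ν → CFZ.LinearFormsCondition k ν`;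
* `RelativeSzemeredi_of_cfz : CFZ.RelativeSzemeredi → GreenTao2008.RelativeSzemeredi`.

The second half of the file runs Green–Tao's §3 deduction of Theorem 1.1 (the tree's
`exists_prime_arithmetic_progression_of_greenTao`, whose proof is repeated verbatim with the
majorisation constant generalised) with respect to an ARBITRARY pseudorandomness notion `P k ν`:
`RelativeSzemerediWith P`, `PseudorandomMajorantWith P` (Prop. 9.1 with `P`-pseudorandom
majorants and some constant `0 < c₀ ≤ 1` in place of `k⁻¹2^{-k-5}`),
`exists_prime_arithmetic_progression_of_transference`. Specialised to
`IsCFZPseudorandom k ν := ν ≥ 0 ∧ CFZ.LinearFormsCondition k ν` this gives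
`exists_prime_arithmetic_progression_of_cfz : CFZ.RelativeSzemeredi → MeasureLinearForms → Thm 1.1`
— the correlation condition (Props. 9.6, 9.10) is not needed on this route.

refactor: (requested by review p10273) the proper end state is to move `RelativeSzemerediWith`,
`PseudorandomMajorantWith` and `exists_prime_arithmetic_progression_of_transference` into
`GreenTao2008.lean` and make `exists_prime_arithmetic_progression_of_greenTao` there a three-line
corollary (the import direction prevents doing it from this file); until then the §3 argument
exists twice in the tree (there with `c₀ = k⁻¹2^{-k-5}`, here with `c₀` general).

## The proof of the comparison

The CFZ system consists of the `k 2^{k-1}` forms `ψ_{j,ω}(x) = ∑_i (j - i) x_i^{(ω_i)}`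
(`ω_j = 0`) in the `2k` variables `x_i^{(c)}`, `i < k`, `c ∈ {0,1}`; Green–Tao's Definition 3.1
allows at most `3k - 4` variables. Every `ψ_{j,ω}` is invariant under the translation
`x_i^{(c)} ↦ x_i^{(c)} + a c_i` with `c = (1, -2, 1, 0, …, 0)` (as `∑_i (j-i) c_i = 0`), so the
average over `ℤ_N^{2k}` equals the average, over the `2k - 1 ≤ 3k - 4` remaining variables, of the
system obtained by deleting the variable `x_0^{(0)}` (normalised to `0` by the translation): an
explicit bijection `ℤ_N^{2k} ≃ ℤ_N × ℤ_N^{2k-1}`. The reduced integer matrix has entries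
`|j - i| ≤ k - 1 ≤ k`, nonzero rows (each `ψ_{j,ω}` involves some `x_i`, `i ∉ {0, j}`, as `k ≥ 3`)
and pairwise non-proportional rows (two distinct pairs `(j,ω) ≠ (j',ω')` are separated by a
variable occurring in exactly one of the two forms, also after the deletion), so Green–Tao's
condition applies with `m ≤ k 2^{k-1}`, `t = 2k - 1`, `L₀ = k`, `b = 0`.

## References

* B. Green, T. Tao, Ann. of Math. 167 (2008), Def. 3.1, Def. 3.3, Thm. 3.5. [cite: GreenTaoAnnals2008]
* D. Conlon, J. Fox, Y. Zhao, EMS Surv. Math. Sci. 1 (2014), 249–282, Def. 4.2, Thm. 4.3 and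
  §1 (comparison of the conditions). [cite: ConlonFoxZhao2014]
-/

noncomputable section

open Filter Finset
open scoped BigOperators

namespace Literature.NumberTheory.Sieve.GreenTao2008

open Literature.Combinatorics.Additive.CFZ (apForm)

/-! ### The coefficient pattern of the CFZ system and its translation symmetry -/

/-- Integer coefficient of the variable `x_v = x_{i}^{(c)}` (`v = (i, c)`) in the CFZ form
`ψ_{j,ω} = ∑_i (j - i) x_i^{(ω_i)}`: `j - i` if `c = ω_i`, else `0`.
[cite: ConlonFoxZhao2014, Definition 4.2] -/
def cfzCoef {k : ℕ} (j : Fin k) (ω : Fin k → Fin 2) (v : Fin k × Fin 2) : ℤ :=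
  if ω v.1 = v.2 then (j : ℤ) - v.1 else 0

/-- The translation vector `c = (1, -2, 1, 0, …, 0)` (`∑_i c_i = ∑_i i c_i = 0`).
[cite: ConlonFoxZhao2014, Section 1 (comparison of the linear forms conditions)] -/
def cfzShift (k : ℕ) (i : Fin k) : ℤ :=
  if (i : ℕ) = 0 then 1 else if (i : ℕ) = 1 then -2 else if (i : ℕ) = 2 then 1 else 0

/-- `|j - i| ≤ k` for the coefficients. [cite: ConlonFoxZhao2014, Definition 4.2] -/
theorem natAbs_cfzCoef_le {k : ℕ} (j : Fin k) (ω : Fin k → Fin 2) (v : Fin k × Fin 2) :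
    (cfzCoef j ω v).natAbs ≤ k := by
  unfold cfzCoef
  split_ifs
  · have hj := j.2; have hi := v.1.2; omega
  · simp

/-- The CFZ form as a sum over all `2k` variables with the coefficients `cfzCoef`.
[cite: ConlonFoxZhao2014, Definition 4.2] -/
theorem apForm_eq_sum_cfzCoef {k N : ℕ} (j : Fin k) (ω : Fin k → Fin 2)
    (x : Fin k → Fin 2 → ZMod N) :
    apForm j ω x = ∑ v : Fin k × Fin 2, (cfzCoef j ω v : ZMod N) * x v.1 v.2 := by
  rw [Literature.Combinatorics.Additive.CFZ.apForm_def, Fintype.sum_prod_type]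
  refine sum_congr rfl fun i _ => ?_
  simp only [cfzCoef]
  rw [Fin.sum_univ_two]
  rcases Fin.exists_fin_two.1 ⟨ω i, rfl⟩ with h | h <;> simp [h]

/-- `∑_i (j - i) c_i = 0` for `c = (1,-2,1,0,…)` and `k ≥ 3`.
[cite: ConlonFoxZhao2014, Section 1 (comparison of the linear forms conditions)] -/
theorem sum_sub_mul_cfzShift {k : ℕ} (hk : 3 ≤ k) (j : ℤ) :
    ∑ i : Fin k, (j - (i : ℕ)) * cfzShift k i = 0 := by
  have hδ : ∀ a : ℕ, a < k → ∑ i : Fin k, (j - (i : ℕ)) * (if (i : ℕ) = a then (1 : ℤ) else 0) = j - a := by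
    intro a ha
    rw [show (∑ i : Fin k, (j - (i : ℕ)) * (if (i : ℕ) = a then (1 : ℤ) else 0)) =
      ∑ i : Fin k, (if i = ⟨a, ha⟩ then (j - (i : ℕ)) else 0) from
        sum_congr rfl fun i _ => by
          by_cases h : i = ⟨a, ha⟩
          · subst h; simp
          · have : (i : ℕ) ≠ a := fun h' => h (Fin.ext h')
            simp [h, this]]
    rw [sum_ite_eq' univ (⟨a, ha⟩ : Fin k) (fun i => j - (i : ℕ)), if_pos (mem_univ _)]
  have hsplit : ∀ i : Fin k, (j - (i : ℕ)) * cfzShift k i =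
      (j - (i : ℕ)) * (if (i : ℕ) = 0 then (1 : ℤ) else 0) +
        (-2) * ((j - (i : ℕ)) * (if (i : ℕ) = 1 then (1 : ℤ) else 0)) +
          (j - (i : ℕ)) * (if (i : ℕ) = 2 then (1 : ℤ) else 0) := by
    intro i
    unfold cfzShift
    have h01 : ¬((i : ℕ) = 0 ∧ (i : ℕ) = 1) := by omega
    by_cases h0 : (i : ℕ) = 0
    · simp [h0]
    · by_cases h1 : (i : ℕ) = 1
      · simp [h1]; ring
      · by_cases h2 : (i : ℕ) = 2
        · simp [h2]
        · simp [h0, h1, h2]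
  simp_rw [hsplit, sum_add_distrib, ← mul_sum]
  rw [hδ 0 (by omega), hδ 1 (by omega), hδ 2 (by omega)]
  push_cast
  ring

/-- Translation invariance of the CFZ forms: `ψ_{j,ω}(x + a·c) = ψ_{j,ω}(x)`.
[cite: ConlonFoxZhao2014, Section 1 (comparison of the linear forms conditions)] -/
theorem sum_cfzCoef_mul_cfzShift {k N : ℕ} (hk : 3 ≤ k) (j : Fin k) (ω : Fin k → Fin 2) :
    ∑ v : Fin k × Fin 2, (cfzCoef j ω v : ZMod N) * (cfzShift k v.1 : ZMod N) = 0 := by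
  have h : ∑ v : Fin k × Fin 2, cfzCoef j ω v * cfzShift k v.1 = 0 := by
    rw [Fintype.sum_prod_type]
    rw [show (∑ i : Fin k, ∑ c : Fin 2, cfzCoef j ω (i, c) * cfzShift k i) =
      ∑ i : Fin k, ((j : ℤ) - (i : ℕ)) * cfzShift k i from sum_congr rfl fun i _ => by
        simp only [cfzCoef]
        rw [Fin.sum_univ_two]
        rcases Fin.exists_fin_two.1 ⟨ω i, rfl⟩ with h | h <;> simp [h]]
    exact sum_sub_mul_cfzShift hk j
  have := congrArg (Int.cast : ℤ → ZMod N) h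
  push_cast at this
  exact this

/-! ### Deleting the variable `x_0^{(0)}` -/

/-- The deleted variable `v₀ = (0, 0)` (needs `k ≥ 1`). [cite: ConlonFoxZhao2014, Definition 4.2] -/
def cfzPivot {k : ℕ} (hk : 1 ≤ k) : Fin k × Fin 2 := (⟨0, hk⟩, 0)

/-- The bijection `ℤ_N^{2k} ≃ ℤ_N × ℤ_N^{2k-1}`: `X ↦ (X(v₀), (X(v) - X(v₀) c_v)_{v ≠ v₀})`.
[cite: ConlonFoxZhao2014, Section 1 (comparison of the linear forms conditions)] -/
def cfzSplit {k : ℕ} (hk : 1 ≤ k) (N : ℕ) :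
    (Fin k × Fin 2 → ZMod N) ≃ ZMod N × ({v : Fin k × Fin 2 // v ≠ cfzPivot hk} → ZMod N) where
  toFun X := (X (cfzPivot hk), fun v => X v - X (cfzPivot hk) * (cfzShift k v.1.1 : ZMod N))
  invFun p := fun v => if h : v = cfzPivot hk then p.1 else p.2 ⟨v, h⟩ + p.1 * (cfzShift k v.1 : ZMod N)
  left_inv X := by
    funext v
    by_cases h : v = cfzPivot hk
    · subst h; simp
    · simp only [dif_neg h]; ring
  right_inv p := by
    rcases p with ⟨a, Y⟩
    refine Prod.ext ?_ ?_
    · show (if h : cfzPivot hk = cfzPivot hk then a else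
        Y ⟨cfzPivot hk, h⟩ + a * (cfzShift k (cfzPivot hk).1 : ZMod N)) = a
      exact dif_pos rfl
    · funext v
      show (if h : (v : Fin k × Fin 2) = cfzPivot hk then a else Y ⟨v, h⟩ + a * (cfzShift k v.1.1 : ZMod N)) -
        (if h : cfzPivot hk = cfzPivot hk then a else
          Y ⟨cfzPivot hk, h⟩ + a * (cfzShift k (cfzPivot hk).1 : ZMod N)) * (cfzShift k v.1.1 : ZMod N) = Y v
      rw [dif_neg v.2, dif_pos rfl]
      ring

/-- The reduced form (variable `v₀` deleted) of `ψ_{j,ω}`.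
[cite: ConlonFoxZhao2014, Section 1 (comparison of the linear forms conditions)] -/
def cfzReducedForm {k N : ℕ} (hk : 1 ≤ k) (j : Fin k) (ω : Fin k → Fin 2)
    (Y : {v : Fin k × Fin 2 // v ≠ cfzPivot hk} → ZMod N) : ZMod N :=
  ∑ v, (cfzCoef j ω v.1 : ZMod N) * Y v

/-- **Key identity:** `ψ_{j,ω}(X) = ψ^{red}_{j,ω}((split X).2)` — the form only sees the `2k-1`
reduced variables. [cite: ConlonFoxZhao2014, Section 1 (comparison of the linear forms conditions)] -/
theorem sum_cfzCoef_eq_reducedForm {k N : ℕ} (hk : 3 ≤ k) (j : Fin k) (ω : Fin k → Fin 2)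
    (X : Fin k × Fin 2 → ZMod N) :
    ∑ v : Fin k × Fin 2, (cfzCoef j ω v : ZMod N) * X v =
      cfzReducedForm (by omega) j ω ((cfzSplit (by omega) N X).2) := by
  classical
  have hk1 : 1 ≤ k := by omega
  set v₀ : Fin k × Fin 2 := cfzPivot hk1 with hv₀
  set a : ZMod N := X v₀ with ha
  -- translation invariance: subtract `a · c`
  have hinv : ∑ v : Fin k × Fin 2, (cfzCoef j ω v : ZMod N) * X v =
      ∑ v : Fin k × Fin 2, (cfzCoef j ω v : ZMod N) * (X v - a * (cfzShift k v.1 : ZMod N)) := by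
    simp only [mul_sub, sum_sub_distrib]
    rw [show (∑ v : Fin k × Fin 2, (cfzCoef j ω v : ZMod N) * (a * (cfzShift k v.1 : ZMod N))) =
      a * ∑ v : Fin k × Fin 2, (cfzCoef j ω v : ZMod N) * (cfzShift k v.1 : ZMod N) by
        rw [mul_sum]; exact sum_congr rfl fun v _ => by ring]
    rw [sum_cfzCoef_mul_cfzShift hk, mul_zero, sub_zero]
  rw [hinv, Fintype.sum_eq_add_sum_subtype_ne _ v₀]
  have h0 : (cfzCoef j ω v₀ : ZMod N) * (X v₀ - a * (cfzShift k v₀.1 : ZMod N)) = 0 := by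
    have : cfzShift k v₀.1 = 1 := by simp [hv₀, cfzPivot, cfzShift]
    rw [this, ha]; push_cast; ring
  rw [h0, zero_add]
  rfl

/-! ### The reduced system as a Green–Tao matrix: bounds and non-degeneracy -/

/-- Each reduced row is nonzero: `ψ_{j,ω}` involves `x_i^{(ω_i)}` for some `i ∉ {0, j}`
(`k ≥ 3`). [cite: ConlonFoxZhao2014, Definition 4.2] -/
theorem exists_cfzCoef_ne_zero {k : ℕ} (hk : 3 ≤ k) (j : Fin k) (ω : Fin k → Fin 2) :
    ∃ v : Fin k × Fin 2, v ≠ cfzPivot (by omega : 1 ≤ k) ∧ cfzCoef j ω v ≠ 0 ∧ v.1 ≠ j := by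
  -- take `i = 1` if `j ≠ 1`, else `i = 2`
  by_cases hj : (j : ℕ) = 1
  · refine ⟨(⟨2, by omega⟩, ω ⟨2, by omega⟩), ?_, ?_, ?_⟩
    · intro h
      have h' := congrArg (fun v : Fin k × Fin 2 => (v.1 : ℕ)) h
      simp [cfzPivot] at h'
    · simp [cfzCoef]; omega
    · intro h; have := congrArg Fin.val h; simp at this; omega
  · refine ⟨(⟨1, by omega⟩, ω ⟨1, by omega⟩), ?_, ?_, ?_⟩
    · intro h
      have h' := congrArg (fun v : Fin k × Fin 2 => (v.1 : ℕ)) h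
      simp [cfzPivot] at h'
    · simp [cfzCoef]; omega
    · intro h; have := congrArg Fin.val h; simp at this; omega

/-- Two distinct normalised pairs `(j,ω) ≠ (j',ω')` (`ω_j = 0 = ω'_{j'}`) have reduced rows that
are not rational multiples of each other. [cite: ConlonFoxZhao2014, Definition 4.2] -/
theorem cfzCoef_not_prop {k : ℕ} (hk : 3 ≤ k) {j j' : Fin k} {ω ω' : Fin k → Fin 2}
    (hω : ω j = 0) (hω' : ω' j' = 0) (hne : (j, ω) ≠ (j', ω')) (c : ℚ) :
    (fun v : {v : Fin k × Fin 2 // v ≠ cfzPivot (by omega : 1 ≤ k)} => (cfzCoef j ω v.1 : ℚ)) ≠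
      c • fun v => (cfzCoef j' ω' v.1 : ℚ) := by
  have hk1 : 1 ≤ k := by omega
  intro h
  have hrow : ∀ v : Fin k × Fin 2, v ≠ cfzPivot hk1 → (cfzCoef j ω v : ℚ) = c * cfzCoef j' ω' v := by
    intro v hv
    have := congrFun h ⟨v, hv⟩
    simpa using this
  -- a nonzero entry of row `(j, ω)` (to exclude `c = 0` making row `(j,ω)` vanish)
  obtain ⟨w, hw0, hwne, -⟩ := exists_cfzCoef_ne_zero hk j ω
  -- helper: an entry where row (j,ω) ≠ 0 but row (j',ω') = 0 gives a contradiction,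
  -- and an entry where row (j,ω) = 0 but row (j',ω') ≠ 0 forces c = 0, hence also a contradiction
  have key1 : ∀ v : Fin k × Fin 2, v ≠ cfzPivot hk1 → cfzCoef j ω v ≠ 0 → cfzCoef j' ω' v = 0 → False := by
    intro v hv h1 h2
    have := hrow v hv
    rw [h2] at this
    simp at this
    exact h1 this
  have key2 : ∀ v : Fin k × Fin 2, v ≠ cfzPivot hk1 → cfzCoef j ω v = 0 → cfzCoef j' ω' v ≠ 0 → False := by
    intro v hv h1 h2
    have h3 := hrow v hv
    rw [h1] at h3
    have hc : c = 0 := by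
      have : c * cfzCoef j' ω' v = 0 := by exact_mod_cast h3.symm
      rcases mul_eq_zero.1 this with h | h
      · exact h
      · exact absurd (by exact_mod_cast h) h2
    have := hrow w hw0
    rw [hc, zero_mul] at this
    exact hwne (by exact_mod_cast this)
  by_cases hjj : j = j'
  · -- same `j`, different `ω`: pick `i` with `ω i ≠ ω' i` (then `i ≠ j`)
    subst hjj
    have hωω : ω ≠ ω' := fun h => hne (by rw [h])
    obtain ⟨i, hi⟩ : ∃ i, ω i ≠ ω' i := by
      by_contra hall; push Not at hall; exact hωω (funext hall)
    have hij : i ≠ j := by rintro rfl; exact hi (by rw [hω, hω'])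
    have hcij : (j : ℤ) - i ≠ 0 := by
      intro h0; apply hij; apply Fin.ext; omega
    -- entry v₁ = (i, ω i): row (j,ω) = j - i ≠ 0, row (j,ω') = 0
    by_cases hv₁ : ((i, ω i) : Fin k × Fin 2) ≠ cfzPivot hk1
    · exact key1 _ hv₁ (by simp [cfzCoef, hcij]) (by simp [cfzCoef, hi.symm])
    · -- then `i = 0`, `ω 0 = 0`, `ω' 0 = 1`: use v₂ = (0, 1) = (i, ω' i)
      push Not at hv₁
      have hv₂ : ((i, ω' i) : Fin k × Fin 2) ≠ cfzPivot hk1 := by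
        intro h2
        apply hi
        have h1' := congrArg Prod.snd hv₁
        have h2' := congrArg Prod.snd h2
        simp at h1' h2'
        rw [h1', h2']
      exact key2 _ hv₂ (by simp [cfzCoef, hi]) (by simp [cfzCoef, hcij])
  · -- different `j`: entry v₁ = (j', ω j') has row (j,ω) = j - j' ≠ 0 and row (j',ω') = 0
    have hc1 : (j : ℤ) - j' ≠ 0 := by
      intro h0; apply hjj; apply Fin.ext; omega
    have hc2 : (j' : ℤ) - j ≠ 0 := by
      intro h0; apply hjj; apply Fin.ext; omega
    by_cases hv₁ : ((j', ω j') : Fin k × Fin 2) ≠ cfzPivot hk1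
    · exact key1 _ hv₁ (by simp [cfzCoef, hc1]) (by simp [cfzCoef])
    · -- then `j' = 0` and `ω 0 = 0`; use v₂ = (j, ω' j): row (j',ω') = j' - j ≠ 0, row (j,ω) = 0
      push Not at hv₁
      have hj'0 : (j' : ℕ) = 0 := by
        have := congrArg Prod.fst hv₁; simp [cfzPivot] at this; exact congrArg Fin.val this |>.trans rfl
      have hv₂ : ((j, ω' j) : Fin k × Fin 2) ≠ cfzPivot hk1 := by
        intro h2
        have := congrArg Prod.fst h2
        simp [cfzPivot] at this
        apply hjj
        apply Fin.ext
        rw [hj'0]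
        exact congrArg Fin.val this
      exact key2 _ hv₂ (by simp [cfzCoef]) (by simp [cfzCoef, hc2])


/-! ### Counting the CFZ forms and variables -/

/-- `{ω ∈ {0,1}^{[n+1]} : ω_j = 0} ≃ {0,1}^{[n]}` (delete the `j`-th coordinate).
[cite: ConlonFoxZhao2014, Definition 4.2] -/
def cfzOmegaEquiv (n : ℕ) (j : Fin (n + 1)) : {ω : Fin (n + 1) → Fin 2 // ω j = 0} ≃ (Fin n → Fin 2) where
  toFun ω := j.removeNth ω.1
  invFun g := ⟨j.insertNth 0 g, by simp⟩
  left_inv ω := by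
    apply Subtype.ext
    simp only
    conv_rhs => rw [← Fin.insertNth_self_removeNth j ω.1]
    rw [ω.2]
  right_inv g := by simp

/-- There are `k 2^{k-1}` normalised pairs `(j, ω)` ("this `2`-blow-up has … `k 2^{k-1}`
edges"). [cite: ConlonFoxZhao2014, Section 4] -/
theorem card_cfzPairs (n : ℕ) :
    #((univ : Finset (Fin (n + 1) × (Fin (n + 1) → Fin 2))).filter (fun e => e.2 e.1 = 0)) =
      (n + 1) * 2 ^ n := by
  have huniv : (univ : Finset (Fin (n + 1) × (Fin (n + 1) → Fin 2))) = univ ×ˢ univ := by ext; simp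
  rw [card_filter, huniv, sum_product]
  have hj : ∀ j : Fin (n + 1), (∑ ω : Fin (n + 1) → Fin 2, if ω j = 0 then 1 else 0) = 2 ^ n := by
    intro j
    rw [← card_filter, ← Fintype.card_subtype, Fintype.card_congr (cfzOmegaEquiv n j),
      Fintype.card_fun, Fintype.card_fin, Fintype.card_fin]
  simp only [hj, sum_const, card_univ, Fintype.card_fin, smul_eq_mul]

/-! ### The comparison of the linear forms conditions -/

/-- **Green–Tao's linear forms condition implies Conlon–Fox–Zhao's** (CFZ §1: "a weakening of
the linear forms condition is sufficient"): for `k ≥ 3`, the `(k 2^{k-1}, 3k-4, k)`-linear forms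
condition of Green–Tao Definition 3.1 implies the `k`-linear forms condition of Conlon–Fox–Zhao
Definition 4.2. Proof: delete the variable `x_0^{(0)}` using the translation symmetry
`c = (1,-2,1,0,…)` (`cfzSplit`, `sum_cfzCoef_eq_reducedForm`), and apply Definition 3.1 to the
reduced integer system (`m ≤ k2^{k-1}`, `t = 2k - 1 ≤ 3k - 4`, entries `≤ k`, `b = 0`; rows nonzero
and non-proportional by `exists_cfzCoef_ne_zero`, `cfzCoef_not_prop`).
[cite: ConlonFoxZhao2014, Section 1 and Definition 4.2] -/
theorem cfzLinearFormsCondition_of_gt {k : ℕ} (hk : 3 ≤ k) {ν : (N : ℕ) → ZMod N → ℝ}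
    (h : LinearFormsCondition (k * 2 ^ (k - 1)) (3 * k - 4) k ν) : Literature.Combinatorics.Additive.CFZ.LinearFormsCondition k ν := by
  classical
  intro E hE ε hε
  have hk1 : 1 ≤ k := by omega
  -- the reduced variables and their count
  set t : ℕ := Fintype.card {v : Fin k × Fin 2 // v ≠ cfzPivot hk1} with ht_def
  have ht : t = 2 * k - 1 := by
    rw [ht_def, Fintype.card_subtype_compl, Fintype.card_prod, Fintype.card_fin, Fintype.card_fin,
      Fintype.card_subtype_eq]
    omega
  have htt : t ≤ 3 * k - 4 := by omega
  -- the forms and their count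
  set m : ℕ := #E with hm_def
  have hm : m ≤ k * 2 ^ (k - 1) := by
    obtain ⟨n, rfl⟩ : ∃ n, k = n + 1 := ⟨k - 1, by omega⟩
    have hsub : E ⊆ (univ : Finset (Fin (n + 1) × (Fin (n + 1) → Fin 2))).filter (fun e => e.2 e.1 = 0) :=
      fun e he => mem_filter.2 ⟨mem_univ _, hE e he⟩
    have := card_le_card hsub
    rw [card_cfzPairs] at this
    simpa using this
  set eV : Fin t ≃ {v : Fin k × Fin 2 // v ≠ cfzPivot hk1} := (Fintype.equivFin _).symm with heV
  set eE : Fin m ≃ E := E.equivFin.symm with heE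
  -- the Green–Tao matrix
  set L : Fin m → Fin t → ℚ := fun a b => (cfzCoef (eE a).1.1 (eE a).1.2 (eV b).1 : ℚ) with hL_def
  have hL : ∀ a b, (L a b).num.natAbs ≤ k ∧ (L a b).den ≤ k := by
    intro a b
    simp only [hL_def, Rat.num_intCast, Rat.den_intCast]
    exact ⟨natAbs_cfzCoef_le _ _ _, hk1⟩
  have hL0 : ∀ a, L a ≠ 0 := by
    intro a h0
    obtain ⟨w, hw, hne, -⟩ := exists_cfzCoef_ne_zero hk (eE a).1.1 (eE a).1.2
    have h1 := congrFun h0 (eV.symm ⟨w, hw⟩)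
    simp only [hL_def, Equiv.apply_symm_apply, Pi.zero_apply, Int.cast_eq_zero] at h1
    exact hne h1
  have hLp : ∀ a a', a ≠ a' → ∀ c : ℚ, L a ≠ c • L a' := by
    intro a a' haa c hprop
    have hne : ((eE a).1.1, (eE a).1.2) ≠ ((eE a').1.1, (eE a').1.2) := by
      intro heq
      apply haa
      apply eE.injective
      apply Subtype.ext
      exact Prod.ext (congrArg Prod.fst heq) (congrArg Prod.snd heq)
    apply cfzCoef_not_prop hk (hE _ (eE a).2) (hE _ (eE a').2) hne c
    funext v
    have h1 := congrFun hprop (eV.symm v)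
    simpa [hL_def] using h1
  -- Green–Tao's condition for this system, with `b = 0`
  filter_upwards [h m t hm htt L hL hL0 hLp ε hε] with N hN
  intro hprime
  have hGT := hN (fun _ => 0)
  -- identify the two averages
  have hcast : ∀ a b, ((L a b : ℚ) : ZMod N) = (cfzCoef (eE a).1.1 (eE a).1.2 (eV b).1 : ZMod N) := by
    intro a b; simp only [hL_def, Rat.cast_intCast]
  have hid : (𝔼 x : Fin k → Fin 2 → ZMod N, ∏ e ∈ E, ν N (apForm e.1 e.2 x)) =
      𝔼 y : Fin t → ZMod N, ∏ a, ν N (∑ b, ((L a b : ℚ) : ZMod N) * y b + (fun _ => (0 : ZMod N)) a) := by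
    -- (1) uncurry and (2) reduce
    have h1 : (𝔼 x : Fin k → Fin 2 → ZMod N, ∏ e ∈ E, ν N (apForm e.1 e.2 x)) =
        𝔼 X : Fin k × Fin 2 → ZMod N, ∏ e ∈ E,
          ν N (cfzReducedForm hk1 e.1 e.2 ((cfzSplit hk1 N X).2)) := by
      symm
      refine Fintype.expect_equiv (Equiv.curry (Fin k) (Fin 2) (ZMod N)) _ _ fun X => ?_
      refine prod_congr rfl fun e _ => ?_
      rw [← sum_cfzCoef_eq_reducedForm hk, apForm_eq_sum_cfzCoef]
      rfl
    -- (3) change variables by the split and (4) drop the first coordinate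
    have h2 : (𝔼 X : Fin k × Fin 2 → ZMod N, ∏ e ∈ E,
          ν N (cfzReducedForm hk1 e.1 e.2 ((cfzSplit hk1 N X).2))) =
        𝔼 Y : {v : Fin k × Fin 2 // v ≠ cfzPivot hk1} → ZMod N, ∏ e ∈ E,
          ν N (cfzReducedForm hk1 e.1 e.2 Y) := by
      rw [Fintype.expect_equiv (cfzSplit hk1 N) _
        (fun p : ZMod N × ({v : Fin k × Fin 2 // v ≠ cfzPivot hk1} → ZMod N) =>
          ∏ e ∈ E, ν N (cfzReducedForm hk1 e.1 e.2 p.2)) (fun X => rfl)]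
      exact Literature.NumberTheory.Sieve.expect_prod_snd
        (fun Y : {v : Fin k × Fin 2 // v ≠ cfzPivot hk1} → ZMod N =>
          ∏ e ∈ E, ν N (cfzReducedForm hk1 e.1 e.2 Y))
    -- (5) reindex forms and variables
    have h3 : (𝔼 Y : {v : Fin k × Fin 2 // v ≠ cfzPivot hk1} → ZMod N, ∏ e ∈ E,
          ν N (cfzReducedForm hk1 e.1 e.2 Y)) =
        𝔼 y : Fin t → ZMod N, ∏ a, ν N (∑ b, ((L a b : ℚ) : ZMod N) * y b + (fun _ => (0 : ZMod N)) a) := by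
      refine Fintype.expect_equiv (Equiv.arrowCongr eV.symm (Equiv.refl (ZMod N))) _ _ fun Y => ?_
      rw [← prod_coe_sort E]
      refine Fintype.prod_equiv eE.symm _ _ fun e => ?_
      simp only [add_zero, hcast, Equiv.apply_symm_apply]
      congr 1
      unfold cfzReducedForm
      symm
      refine Fintype.sum_equiv eV _ _ fun b => ?_
      simp [Equiv.arrowCongr_apply]
    rw [h1, h2, h3]
  rw [hid]
  exact hGT

/-- **Green–Tao 2008, Theorem 3.5, from the Conlon–Fox–Zhao relative Szemerédi theorem**: a
`k`-pseudorandom measure (Def. 3.3) is nonnegative and satisfies Green–Tao's linear forms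
condition, hence (by `cfzLinearFormsCondition_of_gt`) Conlon–Fox–Zhao's, to whose Theorem 4.3 the
statement of Theorem 3.5 then reduces word for word (the correlation condition is not needed).
[cite: ConlonFoxZhao2014, Theorem 4.3] -/
theorem RelativeSzemeredi_of_cfz (hcfz : Literature.Combinatorics.Additive.CFZ.RelativeSzemeredi) : RelativeSzemeredi := by
  intro k hk δ hδ hδ1
  obtain ⟨c, hc, H⟩ := hcfz k hk δ hδ hδ1
  refine ⟨c, hc, fun ν hν η hη => ?_⟩
  exact H ν hν.1 (cfzLinearFormsCondition_of_gt hk hν.2.1) η hη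


/-! ### Theorem 1.1 by transference with respect to an arbitrary pseudorandomness notion -/

/-- Green–Tao's Theorem 3.5 with `IsPseudorandom k` replaced by an arbitrary notion `P k` of
pseudorandomness for families `ν = (ν_N)` (for `P = IsPseudorandom` this is
`RelativeSzemeredi`; for `P k ν = (ν ≥ 0 ∧ CFZ.LinearFormsCondition k ν)` it is
Conlon–Fox–Zhao's Theorem 4.3). [cite: GreenTaoAnnals2008, Theorem 3.5] -/
def RelativeSzemerediWith (P : ℕ → ((N : ℕ) → ZMod N → ℝ) → Prop) : Prop :=
  ∀ k : ℕ, 3 ≤ k → ∀ δ : ℝ, 0 < δ → δ ≤ 1 → ∃ c : ℝ, 0 < c ∧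
    ∀ ν : (N : ℕ) → ZMod N → ℝ, P k ν → ∀ η : ℝ, 0 < η →
      ∀ᶠ N : ℕ in atTop, ∀ [Fact N.Prime], ∀ f : ZMod N → ℝ,
        (∀ x, 0 ≤ f x) → (∀ x, f x ≤ ν N x) → δ ≤ 𝔼 x, f x →
          c - η ≤ 𝔼 x : ZMod N, 𝔼 r : ZMod N, ∏ i : Fin k, f (x + (i : ℕ) * r)

/-- Green–Tao's Proposition 9.1 with `IsPseudorandom k` replaced by an arbitrary notion `P k`
and the majorisation constant `k⁻¹2^{-k-5}` by an arbitrary `0 < c₀ ≤ 1` (a smooth cutoff `χ`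
in `Λ_R` costs a factor `c_χ⁻¹`, Conlon–Fox–Zhao Prop. 8.4 / proof of Prop. 8.1); for
`P = IsPseudorandom` it follows from `PseudorandomMajorant`.
[cite: GreenTaoAnnals2008, Proposition 9.1] -/
def PseudorandomMajorantWith (P : ℕ → ((N : ℕ) → ZMod N → ℝ) → Prop) : Prop :=
  ∀ k : ℕ, 3 ≤ k → ∃ c₀ : ℝ, 0 < c₀ ∧ c₀ ≤ 1 ∧ ∃ G : ℕ → ℕ, Tendsto G atTop atTop ∧
    ∀ w : ℕ → ℕ, Tendsto w atTop atTop → (∀ N, w N ≤ G N) →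
      ∃ ν : (N : ℕ) → ZMod N → ℝ, P k ν ∧
        ∀ᶠ N : ℕ in atTop, N.Prime → ∀ n : ℕ, eps k * N ≤ n → (n : ℝ) ≤ 2 * eps k * N →
          c₀ * modifiedVonMangoldt (primorial (w N)) n ≤ ν N n

/-- `0 < k⁻¹ 2^{-k-5} ≤ 1`, the majorisation constant of Proposition 9.1.
[cite: GreenTaoAnnals2008, Proposition 9.1] -/
theorem majorisationConst_pos_le_one {k : ℕ} (hk : 1 ≤ k) :
    0 < (k : ℝ)⁻¹ * 2⁻¹ ^ (k + 5) ∧ (k : ℝ)⁻¹ * 2⁻¹ ^ (k + 5) ≤ 1 := by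
  have hk0 : (0 : ℝ) < k := by exact_mod_cast hk
  refine ⟨by positivity, ?_⟩
  have h1 : (k : ℝ)⁻¹ ≤ 1 := inv_le_one_of_one_le₀ (by exact_mod_cast hk)
  have h2 : (2⁻¹ : ℝ) ^ (k + 5) ≤ 1 := pow_le_one₀ (by norm_num) (by norm_num)
  exact mul_le_one₀ h1 (by positivity) h2

/-- The two notions specialise to Green–Tao's. [cite: GreenTaoAnnals2008, Theorem 3.5] -/
theorem relativeSzemerediWith_isPseudorandom :
    RelativeSzemerediWith IsPseudorandom ↔ RelativeSzemeredi := Iff.rfl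

/-- Green–Tao's Proposition 9.1 is the case `P = IsPseudorandom`, `c₀ = k⁻¹2^{-k-5}`.
[cite: GreenTaoAnnals2008, Proposition 9.1] -/
theorem pseudorandomMajorantWith_of_pseudorandomMajorant (h : PseudorandomMajorant) :
    PseudorandomMajorantWith IsPseudorandom := fun k hk =>
  ⟨(k : ℝ)⁻¹ * 2⁻¹ ^ (k + 5), (majorisationConst_pos_le_one (by omega)).1,
    (majorisationConst_pos_le_one (by omega)).2, h k hk⟩

end Literature.NumberTheory.Sieve.GreenTao2008

namespace Literature.NumberTheory.Sieve

open GreenTao2008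

/-- **Green–Tao 2008, "Proof of Theorem 1.1 assuming Proposition 9.1" (pp. 523–524), for an
arbitrary pseudorandomness notion `P`** (implying `ν ≥ 0`): the deduction of Theorem 1.1 uses
pseudorandomness only to invoke the relative Szemerédi theorem, so it runs verbatim for any `P`
for which a relative Szemerédi theorem and a majorant are available. The proof is that of
`exists_prime_arithmetic_progression_of_greenTao` (file `GreenTao2008`), word for word.
[cite: GreenTaoAnnals2008, Theorem 1.1 and its proof pp. 523–524] -/
theorem exists_prime_arithmetic_progression_of_transference
    (P : ℕ → ((N : ℕ) → ZMod N → ℝ) → Prop) (hP0 : ∀ k ν, P k ν → ∀ N x, 0 ≤ ν N x)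
    (h₂ : RelativeSzemerediWith P) (h₃ : PseudorandomMajorantWith P) (h₄ : ModifiedVonMangoldtSum) :
    exists_prime_arithmetic_progression := by
  intro k
  -- `k ≤ 2`: the progression `2, 3`
  by_cases hk : k < 3
  · refine ⟨2, 1, one_pos, fun i hi => ?_⟩
    have hi1 : i ≤ 1 := by omega
    interval_cases i <;> norm_num
  push Not at hk
  -- constants
  set ε : ℝ := eps k with hε_def
  have hε : 0 < ε := eps_pos k
  have h2ε : 2 * ε < 1 := two_mul_eps_lt_one k
  have hkε : 2 * k * ε ≤ 1 := two_mul_mul_eps_le_one k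
  -- the majorant (Prop. 9.1 for `P`): constant `c₀`, growth bound `G`; the p. 523 display: `G'`;
  -- choose `w = min(G, G', ⌊log_4 log N⌋)`
  obtain ⟨c₀, hc₀, hc₀1, G, hG, hG'⟩ := h₃ k hk
  obtain ⟨G₄, hG₄, hG₄'⟩ := h₄
  set w : ℕ → ℕ := fun N => min (min (G N) (G₄ N)) ⌊Real.logb 4 (Real.log N)⌋₊ with hw_def
  have hfl : Tendsto (fun N : ℕ => ⌊Real.logb 4 (Real.log N)⌋₊) atTop atTop :=
    tendsto_nat_floor_atTop.comp ((Real.tendsto_logb_atTop (by norm_num)).comp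
      (Real.tendsto_log_atTop.comp tendsto_natCast_atTop_atTop))
  have hmin : ∀ u v : ℕ → ℕ, Tendsto u atTop atTop → Tendsto v atTop atTop →
      Tendsto (fun N => min (u N) (v N)) atTop atTop := by
    intro u v hu hv
    rw [Filter.tendsto_atTop_atTop]
    intro b
    obtain ⟨i₁, hi₁⟩ := Filter.tendsto_atTop_atTop.1 hu b
    obtain ⟨i₂, hi₂⟩ := Filter.tendsto_atTop_atTop.1 hv b
    exact ⟨max i₁ i₂, fun a ha =>
      le_min (hi₁ a (le_of_max_le_left ha)) (hi₂ a (le_of_max_le_right ha))⟩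
  have hw : Tendsto w atTop atTop := hmin _ _ (hmin _ _ hG hG₄) hfl
  have hwG : ∀ N, w N ≤ G N := fun N => (min_le_left _ _).trans (min_le_left _ _)
  have hwG₄ : ∀ N, w N ≤ G₄ N := fun N => (min_le_left _ _).trans (min_le_right _ _)
  have hwlog : ∀ N, w N ≤ ⌊Real.logb 4 (Real.log N)⌋₊ := fun N => min_le_right _ _
  obtain ⟨ν, hν, hmaj⟩ := hG' w hw hwG
  have h4 := hG₄' w hw hwG₄ ε (2 * ε) hε.le (by linarith) h2ε.le
  have hE3 : ∀ᶠ N : ℕ in atTop, ε / 2 ≤ (N : ℝ)⁻¹ *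
      ∑ n ∈ Icc ⌈ε * N⌉₊ ⌊2 * ε * N⌋₊, modifiedVonMangoldt (primorial (w N)) n :=
    h4.eventually_const_le (by linarith)
  -- Theorem 3.5 with `δ = c₀ ε / 2`
  have hδ1 : c₀ * ε / 2 ≤ 1 := by
    have : c₀ * ε ≤ 1 := mul_le_one₀ hc₀1 hε.le (by linarith)
    linarith
  obtain ⟨c, hc, hc'⟩ := h₂ k hk (c₀ * ε / 2) (by positivity) hδ1
  have hE1 := hc' ν hν (c / 2) (half_pos hc)
  -- `(2 c₀ log N)^k ≤ (c/4) N` eventually (`log^k = o(N)`)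
  have hE5 : ∀ᶠ N : ℕ in atTop, (2 * c₀ * Real.log N) ^ k ≤ c / 4 * N := by
    have hlo := (Real.isLittleO_pow_log_id_atTop (n := k)).comp_tendsto
      (tendsto_natCast_atTop_atTop (R := ℝ))
    have hpos : 0 < c / 4 / (2 * c₀) ^ k := by positivity
    filter_upwards [hlo.bound hpos, eventually_ge_atTop 1] with N hN hN1
    have hN' : Real.log N ^ k ≤ c / 4 / (2 * c₀) ^ k * N := by
      have hl0 : 0 ≤ Real.log N := Real.log_nonneg (by exact_mod_cast hN1)
      have h := hN
      simp only [Function.comp_def, id_eq, norm_pow, Real.norm_eq_abs, abs_of_nonneg hl0,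
        Nat.abs_cast] at h
      exact h
    have h2c : (0 : ℝ) < (2 * c₀) ^ k := by positivity
    calc (2 * c₀ * Real.log N) ^ k = (2 * c₀) ^ k * Real.log N ^ k := mul_pow _ _ _
      _ ≤ (2 * c₀) ^ k * (c / 4 / (2 * c₀) ^ k * N) := by gcongr
      _ = c / 4 * N := by field_simp
  -- fix a large prime `N`
  obtain ⟨N₀, hN₀⟩ := Filter.eventually_atTop.1
    (hE1.and (hmaj.and (hE3.and (hE5.and (eventually_ge_atTop 3)))))
  obtain ⟨N, hN₀N, hNp⟩ := Nat.exists_infinite_primes N₀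
  obtain ⟨hE1N, hmajN, hE3N, hE5N, hN3⟩ := hN₀ N hN₀N
  haveI : Fact N.Prime := ⟨hNp⟩
  have hN0 : (0 : ℝ) < N := by exact_mod_cast hNp.pos
  have hlog0 : 0 < Real.log N := by linarith [one_lt_log_of_three_le (show (3 : ℝ) ≤ N by exact_mod_cast hN3)]
  -- `W = W(N)` and its size
  set W : ℕ := primorial (w N) with hW_def
  have hW0 : 0 < W := primorial_pos _
  have hWlog : (W : ℝ) ≤ Real.log N := primorial_le_log hN3 (hwlog N)
  have hWN : (W : ℝ) * N + 1 ≤ (N : ℝ) ^ 2 := by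
    have h1 : Real.log N ≤ N - 1 := Real.log_le_sub_one_of_pos hN0
    have h3 : (1 : ℝ) ≤ N := by exact_mod_cast hNp.one_le
    nlinarith
  have hlogWN : Real.log ((W : ℝ) * N + 1) ≤ 2 * Real.log N := by
    have h2 : Real.log ((N : ℝ) ^ 2) = 2 * Real.log N := by
      rw [Real.log_pow]; norm_num
    rw [← h2]
    exact Real.log_le_log (by positivity) hWN
  -- the function `f` of p. 523
  set f : ZMod N → ℝ := fun x =>
    if ⌈ε * N⌉₊ ≤ x.val ∧ x.val ≤ ⌊2 * ε * N⌋₊ then c₀ * modifiedVonMangoldt W x.val else 0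
    with hf_def
  have hf0 : ∀ x, 0 ≤ f x := fun x => by
    simp only [hf_def]
    split_ifs
    · exact mul_nonneg hc₀.le (modifiedVonMangoldt_nonneg _ _)
    · exact le_rfl
  have hfν : ∀ x, f x ≤ ν N x := fun x => by
    simp only [hf_def]
    split_ifs with hx
    · have h1 : ε * N ≤ (x.val : ℝ) := Nat.ceil_le.mp hx.1
      have h2 : (x.val : ℝ) ≤ 2 * ε * N := (Nat.le_floor_iff (by positivity)).mp hx.2
      have := hmajN hNp x.val h1 h2
      rwa [ZMod.natCast_zmod_val] at this
    · exact hP0 k ν hν N x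
  have hfM : ∀ x, f x ≤ 2 * c₀ * Real.log N := fun x => by
    simp only [hf_def]
    split_ifs with hx
    · have hxN : (x.val : ℝ) ≤ N := by exact_mod_cast (ZMod.val_lt x).le
      calc c₀ * modifiedVonMangoldt W x.val ≤ c₀ * Real.log (W * x.val + 1) := by
            gcongr; exact modifiedVonMangoldt_le_log _ _
        _ ≤ c₀ * Real.log (W * N + 1) := by gcongr
        _ ≤ c₀ * (2 * Real.log N) := by gcongr
        _ = 2 * c₀ * Real.log N := by ring
    · positivity
  -- `E(f) ≥ δ`
  have hlt : ⌊2 * ε * N⌋₊ < N := by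
    rw [Nat.floor_lt (by positivity)]
    calc 2 * ε * N < 1 * N := by gcongr
      _ = N := one_mul _
  have hsum : ∑ x : ZMod N, f x =
      c₀ * ∑ n ∈ Icc ⌈ε * N⌉₊ ⌊2 * ε * N⌋₊, modifiedVonMangoldt W n := by
    have step1 : ∑ x : ZMod N, f x = ∑ n ∈ range N,
        (if ⌈ε * N⌉₊ ≤ n ∧ n ≤ ⌊2 * ε * N⌋₊ then c₀ * modifiedVonMangoldt W n else 0) := by
      refine Finset.sum_nbij' (fun x : ZMod N => x.val) (fun n : ℕ => (n : ZMod N))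
        (fun x _ => mem_range.2 (ZMod.val_lt x)) (fun _ _ => mem_univ _)
        (fun x _ => ZMod.natCast_zmod_val x) (fun n hn => ZMod.val_cast_of_lt (mem_range.1 hn))
        fun x _ => rfl
    rw [step1, ← Finset.sum_filter, ← Finset.mul_sum]
    congr 1
    refine Finset.sum_congr ?_ fun _ _ => rfl
    ext n
    simp only [mem_filter, mem_range, mem_Icc]
    omega
  have hEf : c₀ * ε / 2 ≤ 𝔼 x, f x := by
    rw [Fintype.expect_eq_sum_div_card, ZMod.card, hsum]
    calc c₀ * ε / 2 = c₀ * (ε / 2) := by ring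
      _ ≤ c₀ * ((N : ℝ)⁻¹ * ∑ n ∈ Icc ⌈ε * N⌉₊ ⌊2 * ε * N⌋₊, modifiedVonMangoldt W n) := by
          gcongr
      _ = c₀ * (∑ n ∈ Icc ⌈ε * N⌉₊ ⌊2 * ε * N⌋₊, modifiedVonMangoldt W n) / N := by
          rw [inv_mul_eq_div, mul_div_assoc]
  -- Theorem 3.5
  have hmain : c - c / 2 ≤ 𝔼 x : ZMod N, 𝔼 r : ZMod N, ∏ i : Fin k, f (x + (i : ℕ) * r) :=
    hE1N f hf0 hfν hEf
  -- discard `r = 0`: some `x` and `r ≠ 0` have a nonvanishing product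
  have hex : ∃ x r : ZMod N, r ≠ 0 ∧ ∏ i : Fin k, f (x + (i : ℕ) * r) ≠ 0 := by
    by_contra hcon
    push Not at hcon
    have hr0 : ∀ x : ZMod N,
        𝔼 r : ZMod N, ∏ i : Fin k, f (x + (i : ℕ) * r) = f x ^ k / N := by
      intro x
      rw [Fintype.expect_eq_sum_div_card, ZMod.card, Finset.sum_eq_single (0 : ZMod N)]
      · simp
      · intro r _ hr
        exact hcon x r hr
      · intro h
        exact absurd (Finset.mem_univ _) h
    have hbound : 𝔼 x : ZMod N, 𝔼 r : ZMod N, ∏ i : Fin k, f (x + (i : ℕ) * r) ≤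
        (2 * c₀ * Real.log N) ^ k / N := by
      rw [Fintype.expect_eq_sum_div_card, ZMod.card]
      have h1 : ∑ x : ZMod N, 𝔼 r : ZMod N, ∏ i : Fin k, f (x + (i : ℕ) * r) ≤
          ∑ _x : ZMod N, (2 * c₀ * Real.log N) ^ k / N := by
        refine Finset.sum_le_sum fun x _ => ?_
        rw [hr0 x]
        gcongr
        · exact hf0 x
        · exact hfM x
      rw [Finset.sum_const, Finset.card_univ, ZMod.card, nsmul_eq_mul] at h1
      calc (∑ x : ZMod N, 𝔼 r : ZMod N, ∏ i : Fin k, f (x + (i : ℕ) * r)) / N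
          ≤ (N * ((2 * c₀ * Real.log N) ^ k / N)) / N := by gcongr
        _ = (2 * c₀ * Real.log N) ^ k / N := by field_simp
    have h2 : (2 * c₀ * Real.log N) ^ k / N ≤ c / 4 := by
      rw [div_le_iff₀ hN0]
      exact hE5N
    linarith
  obtain ⟨x, r, hr, hprod⟩ := hex
  have hfi : ∀ i : Fin k, f (x + (i : ℕ) * r) ≠ 0 := fun i =>
    (Finset.prod_ne_zero_iff.mp hprod) i (Finset.mem_univ _)
  -- the representatives `n_i ∈ [ε N, 2 ε N]` with `W n_i + 1` prime
  set n : Fin k → ℕ := fun i => (x + (i : ℕ) * r).val with hn_def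
  have hwin : ∀ i, ⌈ε * N⌉₊ ≤ n i ∧ n i ≤ ⌊2 * ε * N⌋₊ := fun i => by
    by_contra hc
    exact hfi i (by simp only [hf_def]; rw [if_neg hc])
  have hprime : ∀ i, (W * n i + 1).Prime := fun i => by
    have h := hfi i
    simp only [hf_def] at h
    rw [if_pos (hwin i)] at h
    exact prime_of_modifiedVonMangoldt_ne_zero (right_ne_zero_of_mul h)
  have hcong : ∀ i, ((n i : ℕ) : ZMod N) = x + (i : ℕ) * r := fun i => ZMod.natCast_zmod_val _
  -- window length `B ≤ ε N`, and `k B ≤ k ε N ≤ N/2 < N`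
  set B : ℕ := ⌊2 * ε * N⌋₊ - ⌈ε * N⌉₊ with hB_def
  have hkB : k * B < N := by
    have hB : (B : ℝ) ≤ ε * N := by
      have h1 : (⌊2 * ε * N⌋₊ : ℝ) ≤ 2 * ε * N := Nat.floor_le (by positivity)
      have h2 : ε * N ≤ (⌈ε * N⌉₊ : ℝ) := Nat.le_ceil _
      rcases le_or_gt ⌈ε * N⌉₊ ⌊2 * ε * N⌋₊ with h | h
      · have : (B : ℝ) = ⌊2 * ε * N⌋₊ - ⌈ε * N⌉₊ := by
          rw [hB_def, Nat.cast_sub h]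
        linarith
      · have : B = 0 := by rw [hB_def]; omega
        rw [this, Nat.cast_zero]
        positivity
    have : (k : ℝ) * B < N := by
      calc (k : ℝ) * B ≤ k * (ε * N) := by gcongr
        _ = (2 * k * ε) * N / 2 := by ring
        _ ≤ 1 * N / 2 := by gcongr
        _ < N := by linarith
    exact_mod_cast this
  obtain ⟨d, hd, hnd⟩ := exists_int_common_difference (by omega : 2 ≤ k) hkB x r hr n ⌈ε * N⌉₊
    hcong (fun i => (hwin i).1) (fun i => by have := (hwin i).2; rw [hB_def]; omega)
  exact exists_prime_ap_of_window n d hd ⟨0, by omega⟩ hnd hW0 hprime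


/- Sanity check (no new name: the statement is that of the tree's
`exists_prime_arithmetic_progression_of_greenTao`): Green–Tao's original route is the case
`P = IsPseudorandom`. -/
example (h₂ : RelativeSzemeredi) (h₃ : PseudorandomMajorant) (h₄ : ModifiedVonMangoldtSum) :
    exists_prime_arithmetic_progression :=
  exists_prime_arithmetic_progression_of_transference IsPseudorandom (fun _ _ h => h.1) h₂
    (pseudorandomMajorantWith_of_pseudorandomMajorant h₃) h₄

end Literature.NumberTheory.Sieve

/-! ### The Conlon–Fox–Zhao route: Theorem 1.1 from CFZ Theorem 4.3 and Proposition 9.8 -/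

namespace Literature.NumberTheory.Sieve.GreenTao2008

/-- Conlon–Fox–Zhao pseudorandomness: `ν ≥ 0` and the `k`-linear forms condition (Def. 4.2).
[cite: ConlonFoxZhao2014, Definition 4.2] -/
def IsCFZPseudorandom (k : ℕ) (ν : (N : ℕ) → ZMod N → ℝ) : Prop :=
  (∀ N x, 0 ≤ ν N x) ∧ Literature.Combinatorics.Additive.CFZ.LinearFormsCondition k ν

/-- A `k`-pseudorandom measure in Green–Tao's sense is CFZ-pseudorandom.
[cite: ConlonFoxZhao2014, Section 1 (comparison of the linear forms conditions)] -/
theorem IsPseudorandom.isCFZPseudorandom {k : ℕ} (hk : 3 ≤ k) {ν : (N : ℕ) → ZMod N → ℝ}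
    (h : IsPseudorandom k ν) : IsCFZPseudorandom k ν :=
  ⟨h.1, cfzLinearFormsCondition_of_gt hk h.2.1⟩

/-- The Conlon–Fox–Zhao relative Szemerédi theorem is `RelativeSzemerediWith IsCFZPseudorandom`.
[cite: ConlonFoxZhao2014, Theorem 4.3] -/
theorem relativeSzemerediWith_of_cfz (hcfz : Literature.Combinatorics.Additive.CFZ.RelativeSzemeredi) :
    RelativeSzemerediWith IsCFZPseudorandom := by
  intro k hk δ hδ hδ1
  obtain ⟨c, hc, H⟩ := hcfz k hk δ hδ hδ1
  exact ⟨c, hc, fun ν hν η hη => H ν hν.1 hν.2 η hη⟩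

/-- **A CFZ-pseudorandom majorant from Proposition 9.8 alone** (no correlation condition):
the measure `ν` of Definition 9.3 majorises `k⁻¹2^{-k-5} Λ̃` on `[ε_k N, 2ε_k N]` (Lemma 9.4,
`gtMeasure_majorises`) and satisfies Green–Tao's linear forms condition (Prop. 9.8, the named fact
`MeasureLinearForms`, reduced to Prop. 9.5 in `GreenTao2008LinearFormsProofs`), hence CFZ's.
[cite: ConlonFoxZhao2014, Proposition 8.1] -/
theorem cfzMajorant_of_measureLinearForms (h₈ : MeasureLinearForms) :
    PseudorandomMajorantWith IsCFZPseudorandom := by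
  intro k hk
  obtain ⟨G₁, hG₁, H₁⟩ := h₈ k hk
  have hfl : Tendsto (fun N : ℕ => ⌊Real.logb 4 (Real.log N)⌋₊) atTop atTop :=
    tendsto_nat_floor_atTop.comp ((Real.tendsto_logb_atTop (by norm_num)).comp
      (Real.tendsto_log_atTop.comp tendsto_natCast_atTop_atTop))
  refine ⟨(k : ℝ)⁻¹ * 2⁻¹ ^ (k + 5), (majorisationConst_pos_le_one (by omega)).1,
    (majorisationConst_pos_le_one (by omega)).2,
    fun N => min (G₁ N) ⌊Real.logb 4 (Real.log N)⌋₊, tendsto_inf_atTop atTop hG₁ hfl,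
    fun w hw hwG => ?_⟩
  have hw₁ : ∀ N, w N ≤ G₁ N := fun N => (hwG N).trans (min_le_left _ _)
  have hw₃ : ∀ N, w N ≤ ⌊Real.logb 4 (Real.log N)⌋₊ := fun N => (hwG N).trans (min_le_right _ _)
  refine ⟨gtMeasure k w, ⟨gtMeasure_nonneg k w, cfzLinearFormsCondition_of_gt hk (H₁ w hw hw₁)⟩, ?_⟩
  have hk1 : 1 ≤ k := by omega
  have hRε : ∀ᶠ N : ℕ in atTop, gyLevel k N < eps k * N := by
    filter_upwards [(tendsto_gyLevel_div_atTop hk1).eventually (gt_mem_nhds (eps_pos k)),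
      eventually_ge_atTop 1] with N hN hN1
    have hN0 : (0 : ℝ) < N := by exact_mod_cast hN1
    rwa [div_lt_iff₀ hN0] at hN
  filter_upwards [hRε, eventually_ge_atTop 3] with N hRεN hN3 _hNp n h1 h2
  have hN3' : (3 : ℝ) ≤ N := by exact_mod_cast hN3
  have hWN : primorial (w N) ≤ N := by
    have h := primorial_le_log hN3 (hw₃ N)
    have hlog : Real.log N ≤ N := (Real.log_le_sub_one_of_pos (by linarith)).trans (by linarith)
    exact_mod_cast h.trans hlog
  exact gtMeasure_majorises hk1 hWN (one_le_gyLevel (by omega)) hRεN h1 h2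

end Literature.NumberTheory.Sieve.GreenTao2008

namespace Literature.NumberTheory.Sieve

open GreenTao2008

/-- **Green–Tao's Theorem 1.1 by the Conlon–Fox–Zhao route**: the primes contain a `k`-term
arithmetic progression for every `k`, granted the Conlon–Fox–Zhao relative Szemerédi theorem
(EMS Surv. 1 (2014) Thm. 4.3, named fact `Literature.Combinatorics.Additive.CFZ.RelativeSzemeredi`) and Green–Tao's
Proposition 9.8 (`MeasureLinearForms`, itself reduced to the Goldston–Yıldırım Proposition 9.5 in
`GreenTao2008LinearFormsProofs`); the correlation condition and Proposition 9.6 are not needed on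
this route, and the Dirichlet-type input of p. 523 is the proved `ModifiedVonMangoldtSum_holds`.
[cite: ConlonFoxZhao2014, Theorem 1.1 (proof via Theorem 4.3 and Proposition 8.1)] -/
theorem exists_prime_arithmetic_progression_of_cfz (hcfz : Literature.Combinatorics.Additive.CFZ.RelativeSzemeredi)
    (h₈ : MeasureLinearForms) : exists_prime_arithmetic_progression :=
  exists_prime_arithmetic_progression_of_transference IsCFZPseudorandom (fun _ _ h => h.1)
    (relativeSzemerediWith_of_cfz hcfz) (cfzMajorant_of_measureLinearForms h₈)
    ModifiedVonMangoldtSum_holds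

end Literature.NumberTheory.Sieve
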